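import Mathlib
import HarnessLib
import Literature.Analysis.FluidPDE.Tao2016AveragedNS.LocalCascadeSolutions
import Literature.Analysis.FluidPDE.Tao2016AveragedNS.RenormalisedCascadeWaves
import Literature.Analysis.FluidPDE.Tao2016AveragedNS.ViscousEternalSolutions
import Literature.Analysis.FluidPDE.Tao2016AveragedNS.BoundedEternalSolutions
import Summits.NavierStokesRegularity.NavierStokesRegularity.Theorems.TaoLadderRungTwoBreakNoSurvivingEternalViscBddOneFrontSpeedLimit

/-!
# Crux K1ᵛ(1) `TaoLadderRungTwoBreak.NoSurvivingEternalViscBddOne` (stmt-NavierStokesRegularity-20419), child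
# (ρ+) `NoLoudLadderOne` (`ν̂ > 0`): the front of a bounded admissible VISCOUS eternal solution is boxed between
# two clocks — the dissipation line (it cannot be loud above the dissipation cutoff) and the hop-time speed
# limit (unconditional for `ν̂ > 0`) — and every (S₁)-survival event sits above the dissipation line

MODEL lattice ODEs only (Tao 2016 §4 in the self-similar log-time variables of §6.4); nothing in this file
is a statement about the Navier–Stokes equations, and no summit or rung LEAF is proved by it
(`--supports stmt-NavierStokesRegularity-20419 --as helper`).  Any cancelling table, general `m` (the
survival statements at `m = 4`-free generality), every `ε₀ > 0`, `ν̂ > 0`; `C_A = fluxConst α`, `Λ = bigLam ε₀`.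

* `hop_time_visc`, `frontSpeedLimit_visc` — the hop-time lower bound and the front speed limit of
  `…FrontSpeedLimit` with the quiet-past hypothesis DISCHARGED by the tree's `farPastDecay_all`
  (`exists_quietPast_of_visc`): for `ν̂ > 0` they hold for EVERY uniformly bounded admissible eternal solution.
* `loud_le_dissipationLine_visc` — THE DISSIPATION CLOCK: if shell `k` is loud at level `q` at log-time `σ`
  (`q ≤ ‖W_k(σ)‖`), then `q ν̂ (1+ε₀)^{2k} ≤ C_A Λ B² e^{σ}` — a shell can be loud only BELOW the dissipation
  cutoff `k_d(σ)`, `(1+ε₀)^{2k_d(σ)} = C_AΛB²e^{σ}/(qν̂)`; the loud down-set of `…TailBarrier.loud_downset_visc`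
  is finite above at every log-time and its top climbs at most one shell per `2 log(1+ε₀)` of log-time.
* `survival_event_above_dissipationLine` — every event of forward (S_a)-survival
  (`c ≤ physWeight a ε₀ ^ n · e^{2σ}‖W_n(σ)‖²`) of a uniformly bounded admissible viscous eternal solution
  obeys `c ν̂² (1+ε₀)^{4n} ≤ C_A²Λ²B⁴ · physWeight a ε₀ ^ n · e^{4σ}`: at `a = 1` (`physWeight = (1+ε₀)^{-4}`)
  the survival events lie above the line `e^{4σ} ≥ (cν̂²/C_A²Λ²B⁴)(1+ε₀)^{8n}`, i.e. `σ ≥ 2n log(1+ε₀) - O(1)` —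
  exactly the dissipation line: (S₁)-survival is decided AT the dissipation cutoff, neither before nor after.

HONEST LABEL: bookkeeping over landed theorems; `stub_noLoudLadderOne`, `stub_noSurvivingEternalBddOne` and
⟨20419⟩ stay OPEN; rung 0.
-/

noncomputable section

-- the summit and its single sub-problem share the name (CONVENTIONS §1)
set_option linter.dupNamespace false

namespace Summit.NavierStokesRegularity.NavierStokesRegularity.Theorems.NoSurvivingEternalViscBddOne.TailBarrier

open Set Filter Topology MeasureTheory
open scoped RealInnerProductSpace
open Literature.Analysis.FluidPDE Literature.Analysis.FluidPDE.TaoCascade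

variable {m : ℕ} {ε₀ νh : ℝ} {α : Fin m → Fin m → Fin m → ℤ × ℤ × ℤ → ℝ} {W : ℤ → ℝ → Em m}

/-! ## The speed limit, unconditional for `ν̂ > 0` -/

/-- **Hop time, `ν̂ > 0`, unconditional.**  For a uniformly bounded (`‖W‖ ≤ B`) admissible viscous eternal
solution of a cancelling table, a margin level `q` (`4 C_A q ≤ Λ`, `2ΛC_A q² < q`, `q < b = 2ΛC_AB²`): if shell
`n` satisfies `‖W_n‖ ≤ q` on `(-∞, σ]`, then no shell `k ≥ n+1` exceeds `q` before `σ + Δ`,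
`Δ = log((b² - a²)/(b² - q²))`, `a = 2ΛC_A q²`.
[cite: Tao2016AveragedNS, §4 (4.1), (4.3), Lemma 4.1 (4.8)–(4.10); §5; §6.4] -/
theorem hop_time_visc (hε : 0 < ε₀) (hν : 0 < νh) (hW : IsEternalVisc ε₀ νh α W)
    (hc : IsCancellingCoeff α) {B : ℝ} (hB : ∀ (k : ℤ) (σ : ℝ), ‖W k σ‖ ≤ B) {n : ℤ} {σ q : ℝ}
    (hq4 : 4 * fluxConst α * q ≤ bigLam ε₀) (hq2 : 2 * bigLam ε₀ * fluxConst α * q ^ 2 < q)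
    (hqb : q < 2 * bigLam ε₀ * fluxConst α * B ^ 2) (hn : ∀ s, s ≤ σ → ‖W n s‖ ≤ q) :
    ∀ k : ℤ, n + 1 ≤ k → ∀ t,
      t ≤ σ + Real.log (((2 * bigLam ε₀ * fluxConst α * B ^ 2) ^ 2 - (2 * bigLam ε₀ * fluxConst α * q ^ 2) ^ 2)
            / ((2 * bigLam ε₀ * fluxConst α * B ^ 2) ^ 2 - q ^ 2)) →
      ‖W k t‖ ≤ q := by
  have hΛ : 0 < bigLam ε₀ := bigLam_pos (by linarith)
  have hCA : 0 ≤ fluxConst α := fluxConst_nonneg α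
  have hq0 : 0 < q := lt_of_le_of_lt (by positivity) hq2
  obtain ⟨σ₀, hσ₀⟩ := exists_quietPast_of_visc hε hν hW hc ⟨B, hB⟩ (n + 1) hq0
  have h0 : ∀ k : ℤ, n + 1 ≤ k → ∀ s, s ≤ min σ₀ σ → ‖W k s‖ ≤ q :=
    fun k hk s hs => hσ₀ k hk s (hs.trans (min_le_left _ _))
  exact hop_time hε hW hc hB (min_le_right σ₀ σ) hq4 hq2 hqb h0 hn

/-- **Front speed limit, `ν̂ > 0`, unconditional**: in the setting of `hop_time_visc`, every shell `k ≥ n + j`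
satisfies `‖W_k(t)‖ ≤ q` for all `t ≤ σ + jΔ`.
[cite: Tao2016AveragedNS, §4 (4.1), (4.3), Lemma 4.1 (4.8)–(4.10); §5; §6.4] -/
theorem frontSpeedLimit_visc (hε : 0 < ε₀) (hν : 0 < νh) (hW : IsEternalVisc ε₀ νh α W)
    (hc : IsCancellingCoeff α) {B : ℝ} (hB : ∀ (k : ℤ) (σ : ℝ), ‖W k σ‖ ≤ B) {n : ℤ} {σ q : ℝ}
    (hq4 : 4 * fluxConst α * q ≤ bigLam ε₀) (hq2 : 2 * bigLam ε₀ * fluxConst α * q ^ 2 < q)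
    (hqb : q < 2 * bigLam ε₀ * fluxConst α * B ^ 2) (hn : ∀ s, s ≤ σ → ‖W n s‖ ≤ q) :
    ∀ (j : ℕ) (k : ℤ), n + j ≤ k → ∀ t,
      t ≤ σ + j * Real.log (((2 * bigLam ε₀ * fluxConst α * B ^ 2) ^ 2
              - (2 * bigLam ε₀ * fluxConst α * q ^ 2) ^ 2)
            / ((2 * bigLam ε₀ * fluxConst α * B ^ 2) ^ 2 - q ^ 2)) →
      ‖W k t‖ ≤ q := by
  have hΛ : 0 < bigLam ε₀ := bigLam_pos (by linarith)
  have hCA : 0 ≤ fluxConst α := fluxConst_nonneg α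
  have hq0 : 0 < q := lt_of_le_of_lt (by positivity) hq2
  obtain ⟨σ₀, hσ₀⟩ := exists_quietPast_of_visc hε hν hW hc ⟨B, hB⟩ (n + 1) hq0
  have h0 : ∀ k : ℤ, n + 1 ≤ k → ∀ s, s ≤ min σ₀ σ → ‖W k s‖ ≤ q :=
    fun k hk s hs => hσ₀ k hk s (hs.trans (min_le_left _ _))
  exact frontSpeedLimit hε hW hc hB (min_le_right σ₀ σ) hq4 hq2 hqb h0 hn

/-! ## The dissipation clock -/

/-- **A shell can be loud only below the dissipation cutoff** (`ν̂ > 0`): if `q ≤ ‖W_k(σ)‖` for a uniformly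
bounded (`‖W‖ ≤ B`) admissible viscous eternal solution of a cancelling table, then
`q · ν̂ · (1+ε₀)^{2k} ≤ C_A Λ B² e^{σ}` (the tree's `farPastDecay_all` read as a clock: the top of the loud set
satisfies `2k log(1+ε₀) ≤ σ + log(C_AΛB²/(qν̂))`).
[cite: Tao2016AveragedNS, §4 Lemma 4.1 (4.8)–(4.10), Thm. 4.2 (statement shape), §6.4; tree `farPastDecay_all`] -/
theorem loud_le_dissipationLine_visc (hε : 0 < ε₀) (hν : 0 < νh) (hW : IsEternalVisc ε₀ νh α W)
    (hc : IsCancellingCoeff α) {B : ℝ} (hB : ∀ (k : ℤ) (σ : ℝ), ‖W k σ‖ ≤ B)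
    {k : ℤ} {σ q : ℝ} (hloud : q ≤ ‖W k σ‖) :
    q * (νh * (1 + ε₀) ^ ((2 : ℝ) * (k : ℝ))) ≤ fluxConst α * bigLam ε₀ * B ^ 2 * Real.exp σ := by
  have h1 := farPastDecay_all hε hν hW hc hB k σ
  have hpos : 0 < νh * (1 + ε₀) ^ ((2 : ℝ) * (k : ℝ)) :=
    mul_pos hν (Real.rpow_pos_of_pos (by linarith) _)
  have h2 := hloud.trans h1
  rwa [le_div_iff₀ hpos] at h2

/-- **Every (S_a)-survival event sits above the dissipation line** (`ν̂ > 0`): if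
`c ≤ physWeight a ε₀ ^ n · e^{2σ} ‖W_n(σ)‖²` for a uniformly bounded (`‖W‖ ≤ B`) admissible viscous eternal
solution of a cancelling table, then `c · ν̂² · (1+ε₀)^{4n} ≤ physWeight a ε₀ ^ n · e^{2σ} · (C_A Λ B² e^{σ})²`.
At `a = 1` (`physWeight 1 ε₀ = (1+ε₀)^{-4}`) this reads `e^{4σ} ≥ (c ν̂²/(C_AΛB²)²) (1+ε₀)^{8n}`: survival is
decided at log-times `σ ≥ 2n log(1+ε₀) - O(1)`, i.e. AT the dissipation cutoff of the surviving shell.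
[cite: Tao2016AveragedNS, §4 (the viscous equation before Thm. 4.2), Lemma 4.1 (4.8)–(4.10), §6.4; tree `farPastDecay_all`] -/
theorem survival_event_above_dissipationLine (hε : 0 < ε₀) (hν : 0 < νh)
    (hW : IsEternalVisc ε₀ νh α W) (hc : IsCancellingCoeff α)
    {B : ℝ} (hB : ∀ (k : ℤ) (σ : ℝ), ‖W k σ‖ ≤ B) {a c : ℝ} {n : ℕ} {σ : ℝ}
    (hev : c ≤ physWeight a ε₀ ^ n * (Real.exp (2 * σ) * ‖W n σ‖ ^ 2)) :
    c * (νh * (1 + ε₀) ^ ((2 : ℝ) * (n : ℝ))) ^ 2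
      ≤ physWeight a ε₀ ^ n * (Real.exp (2 * σ) * (fluxConst α * bigLam ε₀ * B ^ 2 * Real.exp σ) ^ 2) := by
  have hx : 0 < 1 + ε₀ := by linarith
  have hpw : 0 < physWeight a ε₀ := by
    unfold physWeight
    exact div_pos (Real.rpow_pos_of_pos hx _) (pow_pos hx _)
  have hpos : 0 < νh * (1 + ε₀) ^ ((2 : ℝ) * (n : ℝ)) := mul_pos hν (Real.rpow_pos_of_pos hx _)
  -- the decay bound at shell n, log-time σ
  have h1 := farPastDecay_all hε hν hW hc hB (n : ℤ) σ
  have h1' : ‖W (n : ℤ) σ‖ * (νh * (1 + ε₀) ^ ((2 : ℝ) * (n : ℝ)))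
      ≤ fluxConst α * bigLam ε₀ * B ^ 2 * Real.exp σ := by
    rw [Int.cast_natCast] at h1
    rwa [le_div_iff₀ hpos] at h1
  have h2 : (‖W (n : ℤ) σ‖ * (νh * (1 + ε₀) ^ ((2 : ℝ) * (n : ℝ)))) ^ 2
      ≤ (fluxConst α * bigLam ε₀ * B ^ 2 * Real.exp σ) ^ 2 :=
    pow_le_pow_left₀ (mul_nonneg (norm_nonneg _) hpos.le) h1' 2
  have h3 : 0 ≤ physWeight a ε₀ ^ n * Real.exp (2 * σ) := by positivity
  calc c * (νh * (1 + ε₀) ^ ((2 : ℝ) * (n : ℝ))) ^ 2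
      ≤ physWeight a ε₀ ^ n * (Real.exp (2 * σ) * ‖W n σ‖ ^ 2) * (νh * (1 + ε₀) ^ ((2 : ℝ) * (n : ℝ))) ^ 2 :=
        mul_le_mul_of_nonneg_right hev (by positivity)
    _ = physWeight a ε₀ ^ n * Real.exp (2 * σ)
          * (‖W (n : ℤ) σ‖ * (νh * (1 + ε₀) ^ ((2 : ℝ) * (n : ℝ)))) ^ 2 := by ring
    _ ≤ physWeight a ε₀ ^ n * Real.exp (2 * σ) * (fluxConst α * bigLam ε₀ * B ^ 2 * Real.exp σ) ^ 2 :=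
        mul_le_mul_of_nonneg_left h2 h3
    _ = physWeight a ε₀ ^ n * (Real.exp (2 * σ) * (fluxConst α * bigLam ε₀ * B ^ 2 * Real.exp σ) ^ 2) := by
        ring

/-- **Forward (S_a)-survival pins the survival events to the dissipation line** (`ν̂ > 0`): a forward
(S_a)-surviving uniformly bounded admissible viscous eternal solution has, beyond every `N`, an event
`(n, σ)` with `n, σ ≥ N` AND `c ν̂² (1+ε₀)^{4n} ≤ physWeight a ε₀ ^ n e^{2σ} (C_AΛB²e^{σ})²` — for `a = 1` the
event time is `≥ 2n log(1+ε₀) - O(1)`, at or after the dissipation cutoff of its own shell.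
[cite: Tao2016AveragedNS, §4 (the viscous equation before Thm. 4.2), §6.4; cell predicate `EternalSurvivingFwd`] -/
theorem survivingFwd_events_above_dissipationLine (hε : 0 < ε₀) (hν : 0 < νh)
    (hW : IsEternalVisc ε₀ νh α W) (hc : IsCancellingCoeff α)
    {B : ℝ} (hB : ∀ (k : ℤ) (σ : ℝ), ‖W k σ‖ ≤ B) {a : ℝ} (hS : EternalSurvivingFwd a ε₀ W) :
    ∃ c : ℝ, 0 < c ∧ ∀ N : ℕ, ∃ n : ℕ, N ≤ n ∧ ∃ σ : ℝ, (N : ℝ) ≤ σ ∧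
      c * (νh * (1 + ε₀) ^ ((2 : ℝ) * (n : ℝ))) ^ 2
        ≤ physWeight a ε₀ ^ n * (Real.exp (2 * σ) * (fluxConst α * bigLam ε₀ * B ^ 2 * Real.exp σ) ^ 2) := by
  obtain ⟨c, hc0, hev⟩ := hS
  refine ⟨c, hc0, fun N => ?_⟩
  obtain ⟨n, hn, σ, hσ, h⟩ := hev N
  exact ⟨n, hn, σ, hσ, survival_event_above_dissipationLine hε hν hW hc hB h⟩

end Summit.NavierStokesRegularity.NavierStokesRegularity.Theorems.NoSurvivingEternalViscBddOne.TailBarrier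

end
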